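import Summits.BirchSwinnertonDyer.BirchSwinnertonDyer.Theorems.ClassRecordThreeCartanCoverJacquetGlue
import Literature.NumberTheory.Automorphic.CartanCoverSpanTamePSType
import Literature.RepresentationTheory.FiniteGroups.GL2ModularPrincipalSeriesInvariants
import HarnessLib

/-!
# Crux NUM `CartanOnePlaceDegreeLawAtThree` (stmt-BirchSwinnertonDyer-24801), line `jacquet`, stub 1 `stub_unipotentFixedInSpan` (JVᴸ):
# the GLUE F-typeᴸ ⟹ (JVᴸ), tree-side (Bump's Lemma 4.1.1 in the tree + linear algebra)

Helper file for the (JVᴸ) stub (`--supports stmt-BirchSwinnertonDyer-24801 --as helper`; placement (F-a): bsd-stepL referee g96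
`PLACEMENT-FTYPE`, director-bsd (985)(a)): the named fact `Literature.NumberTheory.Automorphic.cartanCoverSpan_isIsotypic_tamePrincipalSeries` (F-typeᴸ: the cover span of a Cartan-level
`a_ℓ(V)`-eigenform is `(Res_{SL₂(𝔽_q)} Ind_B^{GL₂(𝔽_q)}(χ ⊠ χ⁻¹))^{⊕k}`, `χ` cubic) is taken as an explicit HYPOTHESIS and the statement carrier
`CartanCover.CartanCoverUnipotentFixedInSpan` (JVᴸ, `…CartanCoverJacquetGlue` §1) is CONCLUDED BY NAME:
* `slash_mem_span_of_det_one` — the span of the slashes `F ∣[2] γ` (`γ` in a determinant-one subgroup) is `∣[2] γ₀`-stable (`σ γ₀ = id`);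
* `unipotentFixedInSpan_of_spanTamePSType` — `F₀ = F₀ ∣[2] 1 ∈ S` forces `k ≥ 1`; the tuple `(Δ₁, 0, …, 0)`, `Δ₁ = GL2.deltaBorel χ χ⁻¹` (non-zero,
  `N(𝔽_q)`-invariant: `GL2.deltaBorel_apply_one`, `GL2.principalSeriesRep_upperUnip_deltaBorel`), pulls back along `Φ` to `G ∈ S`, `G ≠ 0`, with
  `Φ (G ∣[2] γ) = Φ G` for every `γ` of upper-unipotent residue `u(t)` (`ḡ⁻¹ = u(−t)`), hence `G ∣[2] γ = G` by injectivity of `Φ` on `S`.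
CONDITIONAL on F-typeᴸ (an explicit hypothesis; no named fact is taken silently). Nothing about (JVᴸ), NUM, 24801 or 19109 is proved for any curve;
counts unmoved; BSD is proved for no curve.
[cite: Bump1997, §4.1 Lemma 4.1.1 and Thm. 4.1.1 p. 406] [cite: ConradDiamondTaylor1999, Lemma 4.2.4 (2) p. 538] [cite: VignerasLNM800, Ch. III §4 Thm. 4.3]
-/

set_option linter.dupNamespace false  -- `Summit.BirchSwinnertonDyer.BirchSwinnertonDyer.…` (summit = problem), as every file of this directory
set_option autoImplicit false

noncomputable section

open scoped Classical Pointwise MatrixGroups ModularForm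

namespace Summit.BirchSwinnertonDyer.BirchSwinnertonDyer.Theorems.CartanCover

open Literature.NumberTheory.Automorphic WeierstrassCurve Literature.NumberTheory.EllipticCurves
open Literature.RepresentationTheory.FiniteGroups

/-! ## §1 The span of the slashes is stable under the cover group -/

/-- The `ℂ`-span of the slashes `F ∣[2] γ` (`γ ∈ Γ`, a subgroup of `GL₂(ℝ)` of determinant one) is stable under `∣[2] γ₀`, `γ₀ ∈ Γ`
(`(F ∣ γ) ∣ γ₀ = F ∣ (γγ₀)`; `ℂ`-linearity of `∣[2] γ₀` because `σ γ₀ = id` for `det γ₀ = 1 > 0`). [cite: Bump1997, §4.1 Eq. (1.6)] -/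
theorem slash_mem_span_of_det_one {Γ : Subgroup (GL (Fin 2) ℝ)} (hΓ : ∀ γ : Γ, ((γ : GL (Fin 2) ℝ)).det = 1)
    (F : UpperHalfPlane → ℂ) (γ₀ : Γ) {G : UpperHalfPlane → ℂ}
    (hG : G ∈ Submodule.span ℂ (Set.range fun γ : Γ => F ∣[(2 : ℤ)] ((γ : GL (Fin 2) ℝ)))) :
    G ∣[(2 : ℤ)] ((γ₀ : GL (Fin 2) ℝ)) ∈ Submodule.span ℂ (Set.range fun γ : Γ => F ∣[(2 : ℤ)] ((γ : GL (Fin 2) ℝ))) := by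
  induction hG using Submodule.span_induction with
  | mem x hx =>
    obtain ⟨γ, rfl⟩ := hx
    refine Submodule.subset_span ⟨γ * γ₀, ?_⟩
    simp only [Subgroup.coe_mul, SlashAction.slash_mul]
  | zero => simp
  | add x y _ _ hx hy => simpa only [SlashAction.add_slash] using Submodule.add_mem _ hx hy
  | smul c x _ hx =>
    have hσ : UpperHalfPlane.σ ((γ₀ : GL (Fin 2) ℝ)) c = c := by
      have hdet : (0 : ℝ) < (((γ₀ : GL (Fin 2) ℝ)) : Matrix (Fin 2) (Fin 2) ℝ).det := by
        rw [← Matrix.GeneralLinearGroup.val_det_apply, hΓ γ₀, Units.val_one]; exact one_pos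
      simp [UpperHalfPlane.σ, hdet]
    rw [ModularForm.smul_slash, hσ]
    exact Submodule.smul_mem _ c hx

/-! ## §2 PROVED: the glue F-typeᴸ ⟹ (JVᴸ) -/

/-- **GLUE: F-typeᴸ ⟹ (JVᴸ).** In `k ≥ 1` copies of the model of `Ind_B^{GL₂(𝔽_q)}(χ ⊠ χ⁻¹)` the tuple `(Δ₁, 0, …, 0)` (`Δ₁ = GL2.deltaBorel`, Bump's
function supported on `B` with `Δ₁(b) = χ(b)`; `Δ₁(1) = 1`, and `ρ(u(t)) Δ₁ = Δ₁`) pulls back along the `Φ` of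
`cartanCoverSpan_isIsotypic_tamePrincipalSeries` to a non-zero `G` in the cover span of `F₀` with `Φ (G ∣[2] γ) = Φ G` for every `γ ∈ ι(O'¹)`
of upper-unipotent residue; `G ∣[2] γ − G ∈ S ∩ ker Φ = 0`. CONDITIONAL on the explicit hypothesis F-typeᴸ.
[cite: Bump1997, §4.1 Lemma 4.1.1 and Thm. 4.1.1 p. 406] [cite: ConradDiamondTaylor1999, Lemma 4.2.4 (2) p. 538] -/
theorem unipotentFixedInSpan_of_spanTamePSType (h : cartanCoverSpan_isIsotypic_tamePrincipalSeries) :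
    CartanCoverUnipotentFixedInSpan := by
  intro D M C X q _ hq h1 hO' S hS red hsurj hker hdet V _ _ N hN hDMC hq3N hc F₀ hF0 hF0e
  obtain ⟨χ, k, Φ, -, -, hinj, -, hsurjΦ, heq⟩ :=
    h D M C X q hq h1 hO' S hS red hsurj hker hdet V N hN hDMC hq3N hc F₀ hF0 hF0e
  -- abbreviation for the span
  set Sp := Submodule.span ℂ (Set.range fun γ : normOneUnits X.ι hO' =>
    (⇑F₀ : UpperHalfPlane → ℂ) ∣[(2 : ℤ)] ((γ : GL (Fin 2) ℝ))) with hSp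
  have hΓ1 : ∀ γ : normOneUnits X.ι hO', ((γ : GL (Fin 2) ℝ)).det = 1 := fun γ =>
    ((mem_normOneUnits_iff X.ι hO').mp γ.2).2.2
  -- `F₀ ∈ S`, so `k ≠ 0`
  have hF0mem : (⇑F₀ : UpperHalfPlane → ℂ) ∈ Sp :=
    Submodule.subset_span ⟨1, by simp⟩
  have hk : 0 < k := by
    rcases Nat.eq_zero_or_pos k with rfl | hk
    · exact absurd (hinj _ hF0mem (funext fun i => Fin.elim0 i)) hF0
    · exact hk
  -- the tuple `(Δ₁, 0, …, 0)`
  set i₀ : Fin k := ⟨0, hk⟩ with hi₀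
  let f : Fin k → (GL (Fin 2) (ZMod q) → ℂ) := fun i =>
    if i = i₀ then ((GL2.deltaBorel χ χ⁻¹ :
      Representation.coindV (GL2.borel (ZMod q)).subtype (scalarRep (GL2.borelCharacter (ZMod q) χ χ⁻¹))) :
        GL (Fin 2) (ZMod q) → ℂ) else 0
  have hf : ∀ i, f i ∈ Representation.coindV (GL2.borel (ZMod q)).subtype
      (scalarRep (GL2.borelCharacter (ZMod q) χ χ⁻¹)) := by
    intro i
    by_cases hi : i = i₀
    · simp only [f, if_pos hi]
      exact (GL2.deltaBorel χ χ⁻¹).2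
    · simp only [f, if_neg hi]
      exact Submodule.zero_mem _
  obtain ⟨G, hG, hΦG⟩ := hsurjΦ f hf
  have hG0 : G ≠ 0 := by
    intro h0
    have h1 : Φ G i₀ 1 = 1 := by
      rw [hΦG]
      simp only [f, if_pos rfl]
      exact GL2.deltaBorel_apply_one χ χ⁻¹
    rw [h0, map_zero] at h1
    exact zero_ne_one h1
  refine ⟨G, hG, hG0, fun γ x hx h00 h10 h11 => ?_⟩
  -- the residue of `γ` is the upper unipotent `u(t)`, `t = (red x)₀₁`
  set t : ZMod q := (red x) 0 1 with ht
  have hred : red x = !![1, t; 0, 1] := by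
    rw [Matrix.eta_fin_two (red x), h00, h10, h11]
  have hg : ((GL2.upperUnip (ZMod q) t : GL (Fin 2) (ZMod q)) : Matrix (Fin 2) (Fin 2) (ZMod q)) = red x := by
    rw [GL2.coe_upperUnip, hred]
  have hinv : (GL2.upperUnip (ZMod q) t)⁻¹ = GL2.upperUnip (ZMod q) (-t) := by
    refine inv_eq_of_mul_eq_one_right ?_
    rw [← GL2.upperUnip_add, add_neg_cancel, GL2.upperUnip_zero]
  -- `Φ (G ∣ γ) = Φ G`
  have hΦ : Φ (G ∣[(2 : ℤ)] ((γ : GL (Fin 2) ℝ))) = Φ G := by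
    rw [heq G hG γ x (GL2.upperUnip (ZMod q) t) hx hg, hinv]
    funext i y
    rw [hΦG]
    by_cases hi : i = i₀
    · simp only [f, if_pos hi]
      have := congrArg (fun v => ((v : Representation.coindV (GL2.borel (ZMod q)).subtype
          (scalarRep (GL2.borelCharacter (ZMod q) χ χ⁻¹))) : GL (Fin 2) (ZMod q) → ℂ) y)
        (GL2.principalSeriesRep_upperUnip_deltaBorel χ χ⁻¹ (-t))
      simpa only [GL2.principalSeriesRep_apply_coe] using this
    · simp only [f, if_neg hi, Pi.zero_apply]
  -- conclude by injectivity on `S`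
  have hmem : G ∣[(2 : ℤ)] ((γ : GL (Fin 2) ℝ)) - G ∈ Sp :=
    Submodule.sub_mem _ (slash_mem_span_of_det_one hΓ1 _ γ hG) hG
  have h0 : Φ (G ∣[(2 : ℤ)] ((γ : GL (Fin 2) ℝ)) - G) = 0 := by rw [map_sub, hΦ, sub_self]
  exact sub_eq_zero.mp (hinj _ hmem h0)

end Summit.BirchSwinnertonDyer.BirchSwinnertonDyer.Theorems.CartanCover

end
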